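import Mathlib
import HarnessLib
import Summits.Langlands.Langlands.Theses.ParityBlindBianchi
import Summits.Langlands.Langlands.Theses.RuelleTorsionArtinWeight
import Summits.Langlands.Langlands.Theorems.ParityBlindBianchiArtinWeightRealisationLevel
import Summits.Langlands.Langlands.Theorems.ParityBlindBianchiArtinWeightRealisationLevelSolvableSector
import Literature.NumberTheory.Automorphic.PiOfArtinRepAtSigmaUnramifiedPlaces
import Literature.NumberTheory.Automorphic.CuspidalRepGL2Exists

/-!
# The common insoluble (icosahedral) core of R′ = `ParityBlindBianchi.ArtinWeightRealisationLevel`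
(crux stmt-Langlands-15111) and the shared crux R = `RuelleTorsionArtinWeight.ArtinWeightRealisation`
(stmt-Langlands-11057) — line `Sketch`, continuation lead c2 (`--supports`)

Landed so far: `R′ → R` unconditionally and `R′ ↔ R` modulo Gelbart 1997 Prop. 4.1 (σ-unramified
shadow, `hG`) and the existence of a cuspidal automorphic representation of `GL₂` over every number
field (`hC`) (both in `…SharedOfLevel`); and R′ follows from ITS OWN insoluble sector modulo
Langlands–Tunnell (`strongArtin_of_isSolvable`, `hLT`) and `hG` (`…IcosahedralResidue`).  This file
closes the square on the side of the SHARED crux R, whose conclusion is almost-everywhere and whose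
solvable sector therefore needs Langlands–Tunnell ALONE (no rigidity, no cusp-form existence):

* `eventually_satakeFrobCompatibleAt_of_isSolvable_projectiveImage` : `hLT →` for finite-image
  irreducible `σ : Γ_K → GL₂(ℚ̄_p)` with solvable projective image, some cuspidal `π` has
  `SatakeFrobCompatibleAt ι π σ w` for almost all `w` (any number field `K`, no hypothesis on `σ`
  beyond these; the a.e. step of `satakeFrobCompatibleAt_of_isSolvable_projectiveImage`);
* `artinWeightRealisation_of_insoluble_sector` : `hLT → (R restricted to ¬ IsSolvable
  (projectiveImage σ)) → R` — the open content of item 11057 is exactly its icosahedral sector;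
* `artinWeightRealisationLevel_of_artinWeightRealisation_insoluble` :
  `hLT → hG → hC → (R restricted) → R′` — the crux BY NAME from the icosahedral sector of the
  SHARED crux and three classical named facts.

Consequence (kernel-checked, with `artinWeightRealisation_of_artinWeightRealisationLevel` of
`…SharedOfLevel` and `artinWeightRealisationLevel_of_insoluble_sector` of `…IcosahedralResidue`; the
remaining arrow `(R′ restricted) → (R restricted)` is the companion file `…InsolubleCoreConverse`):
modulo {Langlands–Tunnell, Gelbart 4.1 σ-shadow, cusp forms on `GL₂/F` exist} the statements R, R′
and R|icosahedral are pairwise equivalent; the single open core of both cruxes is "a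
`p`-adically automorphic (generic `IsHeckePoint`, Hansen-associated off a finite set) irreducible `σ : Γ_K → GL₂(ℚ̄_p)` with finite image and
projective image `A₅`, `K` imaginary quadratic, is Satake–Frobenius compatible a.e. with a cuspidal
`π` of `GL₂(𝔸_K)`" — singular-weight classicality in the icosahedral case.  The restrictions are
HYPOTHESES written out verbatim (the item statements with `¬ IsSolvable (projectiveImage
σ.toMonoidHom) →` inserted after irreducibility); nothing is claimed about them.  No definitions.
-/

noncomputable section

open scoped BigOperators Topology Classical Matrix NumberField MatrixGroups
open Literature.NumberTheory.Automorphic Literature.NumberTheory.GaloisRepresentations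
  IsDedekindDomain NumberField Filter

-- `Summit.Langlands.Langlands.…`: summit = sub-problem name (D-0017 nested layout), not a typo.
set_option linter.dupNamespace false

namespace Summit.Langlands.Langlands.Theorems.ArtinWeightRealisationLevel

/-- **The solvable sector of the shared crux R needs Langlands–Tunnell alone.**  Under
`strongArtin_of_isSolvable` (Langlands–Tunnell in automorphic form), for every number field `K`,
prime `p`, `ι : ℚ̄_p ≃+* ℂ` and `σ : Γ_K → GL₂(ℚ̄_p)` continuous with finite image, irreducible,
with solvable projective image, some cuspidal `π` of `GL₂(𝔸_K)` has
`SatakeFrobCompatibleAt ι π σ w` for all but finitely many `w`.  Proof: `π := π(τ)` for the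
contragredient transport `τ = ι ∘ σ^∨` (`exists_dual_transport_projectiveImage`,
`isIrreducible_of_dual_transport`, `isSolvable_projectiveImage_of_dual_transport`), and the
pointwise dictionary `satakeFrobCompatibleAt_iff_of_dual_transport`. [folklore] -/
theorem eventually_satakeFrobCompatibleAt_of_isSolvable_projectiveImage :
    strongArtin_of_isSolvable → ∀ (K : Type) [Field K] [NumberField K] (p : ℕ) [Fact p.Prime]
      (ι : PadicAlgCl p ≃+* ℂ) (σ : FramedGaloisRep K (PadicAlgCl p) 2), Finite σ.toMonoidHom.range →
      σ.toGaloisRep.IsIrreducible → IsSolvable (projectiveImage σ.toMonoidHom) →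
      ∃ (hcpt : isCompact_glFiniteIntegralLevel 2 K) (π : CuspidalAutomorphicRepData 2 K hcpt),
        ∀ᶠ w : HeightOneSpectrum (𝓞 K) in Filter.cofinite,
          Summit.Langlands.SatakeFrobCompatibleAt ι π.1 σ w := by
  intro hLT K _ _ p _ ι σ hfin hirr hsolv
  obtain ⟨τ, hτ, hfinτ, ⟨e⟩⟩ := exists_dual_transport_projectiveImage ι σ hfin
  have hirrτ : τ.toGaloisRep.IsIrreducible := isIrreducible_of_dual_transport σ hirr τ hfinτ e
  have hsolvτ : IsSolvable (projectiveImage τ.toMonoidHom) :=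
    isSolvable_projectiveImage_of_dual_transport σ hsolv τ e
  obtain ⟨hcpt, π, hpi⟩ := hLT τ hirrτ hsolvτ
  exact ⟨hcpt, π,
    hpi.mono fun w hw => (satakeFrobCompatibleAt_iff_of_dual_transport ι σ τ hτ π.1 w).2 hw⟩

/-- **The shared crux R reduces to its insoluble (icosahedral) sector, modulo Langlands–Tunnell
only.**  `RuelleTorsionArtinWeight.ArtinWeightRealisation` (item stmt-Langlands-11057) follows
from `strongArtin_of_isSolvable` and its own restriction to finite-image irreducible `σ` whose
projective image is NOT solvable (second hypothesis: the statement of R verbatim with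
`¬ IsSolvable (projectiveImage σ.toMonoidHom)` inserted after irreducibility).  In the solvable
sector the `p`-adic automorphy hypothesis is not used at all
(`eventually_satakeFrobCompatibleAt_of_isSolvable_projectiveImage`). [folklore] -/
theorem artinWeightRealisation_of_insoluble_sector : Literature.NumberTheory.Automorphic.strongArtin_of_isSolvable → (∀ (K : Type) [Field K] [NumberField K], NumberField.IsTotallyComplex K → Module.finrank ℚ K = 2 → ∀ (p : ℕ) [Fact p.Prime] (ι : PadicAlgCl p ≃+* ℂ) (σ : Literature.NumberTheory.GaloisRepresentations.FramedGaloisRep K (PadicAlgCl p) 2), Finite σ.toMonoidHom.range → σ.toGaloisRep.IsIrreducible → ¬ IsSolvable (Literature.NumberTheory.GaloisRepresentations.projectiveImage σ.toMonoidHom) → (∃ (S : Finset (IsDedekindDomain.HeightOneSpectrum (NumberField.RingOfIntegers K))) (U : Subgroup (GL (Fin 2) (IsDedekindDomain.FiniteAdeleRing (NumberField.RingOfIntegers K) K))) (ϖ : ∀ v : IsDedekindDomain.HeightOneSpectrum (NumberField.RingOfIntegers K), (v.adicCompletion K)ˣ) (a : {v : IsDedekindDomain.HeightOneSpectrum (NumberField.RingOfIntegers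 K) // v ∉ S} → ℕ → (Valued.v (R := PadicAlgCl p)).valuationSubring), (∀ v : IsDedekindDomain.HeightOneSpectrum (NumberField.RingOfIntegers K), ((p : ℕ) : NumberField.RingOfIntegers K) ∈ v.asIdeal → v ∈ S) ∧ IsOpen (U : Set (GL (Fin 2) (IsDedekindDomain.FiniteAdeleRing (NumberField.RingOfIntegers K) K))) ∧ U ≤ Literature.NumberTheory.Automorphic.glFiniteIntegralLevel 2 K ∧ (∀ g ∈ Literature.NumberTheory.Automorphic.glFiniteIntegralLevel 2 K, (∀ v ∈ S, ∀ i j : Fin 2, ((g : Matrix (Fin 2) (Fin 2) (IsDedekindDomain.FiniteAdeleRing (NumberField.RingOfIntegers K) K)) i j) v = (1 : Matrix (Fin 2) (Fin 2) (v.adicCompletion K)) i j) → g ∈ U) ∧ (∀ v : IsDedekindDomain.HeightOneSpectrum (NumberField.RingOfIntegers K), Valued.v ((ϖ v : (v.adicCompletion K)ˣ) : v.adicCompletion K) = WithZero.exp (-1 : ℤ)) ∧ Literature.NumberTheory.Automorphic.IsHeckePoint (Matrix.GeneralLinearGroup.map (n := Fin 2) (algebraMap K (IsDedekindDomain.FiniteAdeleRing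 (NumberField.RingOfIntegers K) K))) (Literature.NumberTheory.Automorphic.LevelTower.ofSeq U (fun r : ℕ => (Literature.NumberTheory.Automorphic.principalCongruenceLevel 2 K (Ideal.span {((p : ℕ) : NumberField.RingOfIntegers K)} ^ r)).map (Literature.NumberTheory.Automorphic.GLn.sndHom 2 K))) ((p : ℕ) : (Valued.v (R := PadicAlgCl p)).valuationSubring) (fun j : {v : IsDedekindDomain.HeightOneSpectrum (NumberField.RingOfIntegers K) // v ∉ S} × Fin 2 => Literature.NumberTheory.Automorphic.GLn.sndHom 2 K (Literature.NumberTheory.Automorphic.heckeDiagAt 2 K j.1.1 (ϖ j.1.1) (j.2.val + 1))) (fun j => a j.1 (j.2.val + 1)) ∧ ∀ (v : IsDedekindDomain.HeightOneSpectrum (NumberField.RingOfIntegers K)) (hv : v ∉ S), σ.IsHeckeAssociatedAt v (fun i : ℕ => if i = 0 then (1 : PadicAlgCl p) else ((a ⟨v, hv⟩ i : (Valued.v (R := PadicAlgCl p)).valuationSubring) : PadicAlgCl p))) → ∃ (hcpt : Literature.NumberTheory.Automorphic.isCompact_glFiniteIntegralLevel 2 K) (π : Literature.NumberTheory.Automorphic.CuspidalAutomorphicRepData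 2 K hcpt), ∀ᶠ w : IsDedekindDomain.HeightOneSpectrum (NumberField.RingOfIntegers K) in Filter.cofinite, Summit.Langlands.SatakeFrobCompatibleAt ι π.1 σ w) → Summit.Langlands.Langlands.Theses.RuelleTorsionArtinWeight.ArtinWeightRealisation := by
  intro hLT hcore K _ _ htc hdeg p _ ι σ hfin hirr hyp
  by_cases hs : IsSolvable (projectiveImage σ.toMonoidHom)
  · exact eventually_satakeFrobCompatibleAt_of_isSolvable_projectiveImage hLT K p ι σ hfin hirr hs
  · exact hcore K htc hdeg p ι σ hfin hirr hs hyp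

/-- **R′ (the crux BY NAME) from the icosahedral sector of the SHARED crux R and three classical
named facts**: Langlands–Tunnell in automorphic form (`strongArtin_of_isSolvable`), the
σ-unramified shadow of Gelbart 1997 Prop. 4.1 (`hG`, written out; Literature
`frobSatakeCompatibleAt_of_isPiOfArtinRep_of_isUnramifiedAt`) and the existence of a cuspidal
automorphic representation of `GL₂` over every number field (`hC`, written out; Literature
`nonempty_cuspidalAutomorphicRepData_two`, consumed only by the degenerate sector `0 ∈ S₀`).
Composition of `artinWeightRealisation_of_insoluble_sector` with the landed
`artinWeightRealisationLevel_of_artinWeightRealisation`.  Together with the unconditional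
`artinWeightRealisation_of_artinWeightRealisationLevel` (`…SharedOfLevel`) and the trivial
restriction R → R|icosahedral this makes R, R′ and the icosahedral sector of R pairwise
equivalent modulo the three facts. [folklore] -/
theorem artinWeightRealisationLevel_of_artinWeightRealisation_insoluble : Literature.NumberTheory.Automorphic.strongArtin_of_isSolvable → (∀ {F : Type} [Field F] [NumberField F] (hcpt : isCompact_glFiniteIntegralLevel 2 F) (σ : FramedArtinRep F 2) (π : CuspidalAutomorphicRepData 2 F hcpt), IsPiOfArtinRep σ π.1 → ∀ v : HeightOneSpectrum (𝓞 F), σ.IsUnramifiedAt v → FrobSatakeCompatibleAt σ π.1 v) → (∀ (F : Type) [Field F] [NumberField F] (hF : isCompact_glFiniteIntegralLevel 2 F), Nonempty (CuspidalAutomorphicRepData 2 F hF)) → (∀ (K : Type) [Field K] [NumberField K], NumberField.IsTotallyComplex K → Module.finrank ℚ K = 2 → ∀ (p : ℕ) [Fact p.Prime] (ι : PadicAlgCl p ≃+* ℂ) (σ : Literature.NumberTheory.GaloisRepresentations.FramedGaloisRep K (PadicAlgCl p) 2), Finite σ.toMonoidHom.range → σ.toGaloisRep.IsIrreducible → ¬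 IsSolvable (Literature.NumberTheory.GaloisRepresentations.projectiveImage σ.toMonoidHom) → (∃ (S : Finset (IsDedekindDomain.HeightOneSpectrum (NumberField.RingOfIntegers K))) (U : Subgroup (GL (Fin 2) (IsDedekindDomain.FiniteAdeleRing (NumberField.RingOfIntegers K) K))) (ϖ : ∀ v : IsDedekindDomain.HeightOneSpectrum (NumberField.RingOfIntegers K), (v.adicCompletion K)ˣ) (a : {v : IsDedekindDomain.HeightOneSpectrum (NumberField.RingOfIntegers K) // v ∉ S} → ℕ → (Valued.v (R := PadicAlgCl p)).valuationSubring), (∀ v : IsDedekindDomain.HeightOneSpectrum (NumberField.RingOfIntegers K), ((p : ℕ) : NumberField.RingOfIntegers K) ∈ v.asIdeal → v ∈ S) ∧ IsOpen (U : Set (GL (Fin 2) (IsDedekindDomain.FiniteAdeleRing (NumberField.RingOfIntegers K) K))) ∧ U ≤ Literature.NumberTheory.Automorphic.glFiniteIntegralLevel 2 K ∧ (∀ g ∈ Literature.NumberTheory.Automorphic.glFiniteIntegralLevel 2 K, (∀ v ∈ S, ∀ i j : Fin 2, ((g : Matrix (Fin 2) (Fin 2) (IsDedekindDomain.FiniteAdeleRing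 (NumberField.RingOfIntegers K) K)) i j) v = (1 : Matrix (Fin 2) (Fin 2) (v.adicCompletion K)) i j) → g ∈ U) ∧ (∀ v : IsDedekindDomain.HeightOneSpectrum (NumberField.RingOfIntegers K), Valued.v ((ϖ v : (v.adicCompletion K)ˣ) : v.adicCompletion K) = WithZero.exp (-1 : ℤ)) ∧ Literature.NumberTheory.Automorphic.IsHeckePoint (Matrix.GeneralLinearGroup.map (n := Fin 2) (algebraMap K (IsDedekindDomain.FiniteAdeleRing (NumberField.RingOfIntegers K) K))) (Literature.NumberTheory.Automorphic.LevelTower.ofSeq U (fun r : ℕ => (Literature.NumberTheory.Automorphic.principalCongruenceLevel 2 K (Ideal.span {((p : ℕ) : NumberField.RingOfIntegers K)} ^ r)).map (Literature.NumberTheory.Automorphic.GLn.sndHom 2 K))) ((p : ℕ) : (Valued.v (R := PadicAlgCl p)).valuationSubring) (fun j : {v : IsDedekindDomain.HeightOneSpectrum (NumberField.RingOfIntegers K) // v ∉ S} × Fin 2 => Literature.NumberTheory.Automorphic.GLn.sndHom 2 K (Literature.NumberTheory.Automorphic.heckeDiagAt 2 K j.1.1 (ϖ j.1.1) (j.2.val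 + 1))) (fun j => a j.1 (j.2.val + 1)) ∧ ∀ (v : IsDedekindDomain.HeightOneSpectrum (NumberField.RingOfIntegers K)) (hv : v ∉ S), σ.IsHeckeAssociatedAt v (fun i : ℕ => if i = 0 then (1 : PadicAlgCl p) else ((a ⟨v, hv⟩ i : (Valued.v (R := PadicAlgCl p)).valuationSubring) : PadicAlgCl p))) → ∃ (hcpt : Literature.NumberTheory.Automorphic.isCompact_glFiniteIntegralLevel 2 K) (π : Literature.NumberTheory.Automorphic.CuspidalAutomorphicRepData 2 K hcpt), ∀ᶠ w : IsDedekindDomain.HeightOneSpectrum (NumberField.RingOfIntegers K) in Filter.cofinite, Summit.Langlands.SatakeFrobCompatibleAt ι π.1 σ w) → Summit.Langlands.Langlands.Theses.ParityBlindBianchi.ArtinWeightRealisationLevel :=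
  fun hLT hG hC hcore => artinWeightRealisationLevel_of_artinWeightRealisation
    (artinWeightRealisation_of_insoluble_sector hLT hcore) hG hC

end Summit.Langlands.Langlands.Theorems.ArtinWeightRealisationLevel

end
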